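-- PORTED from the prior programme stockroom (kernel-checked there, proofs untouched):
--   reserve/prior-2001/Prior/HodgeConjecture/HodgeConjecture/Hodge_WRankFourWeilFacesY1_Qw8Sufficiency.lean
-- Changes: `import HarnessLib` dropped; outer namespace -> HodgeCM.Prior.Qw8Sufficiency. Attribution: 2001 programme seats (docstrings).

import Mathlib

/-!
# Prior-program stockroom file `Hodge_WRankFourWeilFacesY1_Qw8Sufficiency`

Imported from the 2001 program: `summits/hodge-w-rank-four-weil-faces/free/y1/lean/Qw8Sufficiency.lean` (commit a463a4c8cc18),
free `y1` of summit `hodge-w-rank-four-weil-faces`; prior STATUS `upheld`; imported 2026-08-13.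
Relevant to: Summit.HodgeConjecture.HodgeConjecture (the statement via the prior narrowed target `hodge-w-rank-four-weil-faces`); container free `y1`
Inspiration note: none (not a primary-summit route).
Existing Theses decls it bears on: not assessed at import (planners/provers decide; see reserve/prior-2001/README.md).
Mechanical changes only: provenance header, whole body wrapped in the namespace below (original namespaces nested
inside), stub docstrings on undocumented declarations, `#print`/`#check`/`#eval` lines dropped. Proofs untouched.
NOT part of the `lean/` tree: it enters `Summits/…/Theorems` only when a prover adapts it to a Theses decl (route item).
-/

namespace HodgeCM.Prior.Qw8Sufficiency

/-
T2 — [QW8] Theorem 2.5 "Sufficiency" (label t:suff), combinatorial core.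
Source: literature/sources/internal-hodge-w-quartic-weil-eightfold-y3/paper-v1-892bb948.tex
(the refereed v1), Theorem 2.5 at lines 245-249, proof (i)-(v) at lines 250-262; the
Lefschetz character a(·) is Definition 2.3 (lines 212-221), Milne's input is (2.1) =
eq:milne (lines 205-207) with Lemma 2.4(b) (l:Linv, lines 222-231).

Statement as printed (l.245-249): "Let w₁,…,wₙ be algebraic classes with Q̄-coefficients on
varieties Y_α ∼ ∏_O C_O^{n_{O,α}}, each a T-weight vector, and let e be a T-weight vector in
H_{2q}(Y,Q̄), Y ∼ ∏_O C_O^{n_O}.  If a(e) = ∑_α ε_α a(w_α) with ε_α = ±1, then e is algebraic."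

Abstraction (per the special charge: "formalize its combinatorial core … with 'algebraic' an
abstract predicate satisfying the closure axioms the proof uses — list those axioms explicitly
as hypotheses").  `Cl` stands for the pool of T-weight vectors on all the varieties
∏_O C_O^{n_O} at once (the proof moves freely between Y, Y_α, ∏Y_α, Y × Y'), `V` for the value
group ⨁_O Asym(O) of the Lefschetz character, and the five proof steps (i)-(v) become five
operations/axioms:
  conj  + alg_conj + achar_conj : step (i)  — γ ∈ Aut(Q̄/Q) inducing ι on F flips a;
  mul   + alg_mul  + achar_mul  : step (ii) — exterior product w₁ ⊠ ⋯ ⊠ wₙ adds a;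
  dual  + achar_dual            : step (iii) — the Poincaré pairing partner w^∨ with
                                  a(w^∨) = -a(w), ⟨w,w^∨⟩ = 1 (w^∨ is NOT assumed algebraic);
  milne                         : step (iv) — a weight vector with a = 0 is L(A)-invariant
                                  (Lemma 2.4(b)) hence a Lefschetz class ((2.1), Milne 1999),
                                  hence algebraic — THE geometric input;
  pushpull                      : step (v)  — e = pr_{Y*}((e ⊠ w^∨)·pr_{Y'}^* w), using
                                  ⟨w,w^∨⟩ = 1: if e ⊠ w^∨ and w are algebraic, so is e.
The theorems: `sufficiency` (ε = ±1, the printed statement), `sufficiency_int` (arbitrary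
integer coefficients, the form consumed by COR-CM (b3)/(1e): "Repetitions of w_α are allowed
(n arbitrary), so integer coefficients c_α are covered"), and `algAcharSubgroup`
(Remark 2.6(c): the a-values of algebraic weight vectors form a subgroup of V).
Instance smoke tests at the end show the axioms are satisfiable with alg ≠ ⊤ (so the
structure is not vacuous and does not force everything to be "algebraic").
-/
namespace Qw8Sufficiency

/-- The abstract Lefschetz-character calculus of [QW8] §2: exactly the interface that the
five-step proof of Theorem 2.5 uses. -/
structure LefschetzCalculus (V : Type*) [AddCommGroup V] (Cl : Type*) where
  /-- "is (the class of) an algebraic cycle with Q̄-coefficients" -/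
  alg : Cl → Prop
  /-- the Lefschetz character a(·) of Definition 2.3 -/
  achar : Cl → V
  /-- step (i): apply γ ∈ Aut(Q̄/Q) inducing ι on F to the coefficients -/
  conj : Cl → Cl
  /-- step (ii): exterior (box) product -/
  mul : Cl → Cl → Cl
  /-- step (iii): the Poincaré-dual pairing partner w^∨ (not assumed algebraic) -/
  dual : Cl → Cl
  alg_conj : ∀ w, alg w → alg (conj w)
  achar_conj : ∀ w, achar (conj w) = - achar w
  alg_mul : ∀ v w, alg v → alg w → alg (mul v w)
  achar_mul : ∀ v w, achar (mul v w) = achar v + achar w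
  achar_dual : ∀ w, achar (dual w) = - achar w
  /-- step (iv): a weight vector with vanishing Lefschetz character is algebraic
      (Lemma 2.4(b) + (2.1); Milne 1999 Thm 4.4/Cor 4.5/Cor 4.7) -/
  milne : ∀ z, achar z = 0 → alg z
  /-- step (v): e = pr_{Y*}((e ⊠ w^∨) · pr_{Y'}^* w) with ⟨w, w^∨⟩ = 1 -/
  pushpull : ∀ e w, alg (mul e (dual w)) → alg w → alg e

namespace LefschetzCalculus

variable {V : Type*} [AddCommGroup V] {Cl : Type*} (C : LefschetzCalculus V Cl)

/-- Steps (iii)-(v) assembled: an algebraic weight vector with the same Lefschetz character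
makes `e` algebraic. -/
theorem alg_of_achar_eq {e w : Cl} (hw : C.alg w) (h : C.achar e = C.achar w) :
    C.alg e := by
  have hz : C.achar (C.mul e (C.dual w)) = 0 := by
    rw [C.achar_mul, C.achar_dual, h, add_neg_cancel]
  exact C.pushpull e w (C.milne _ hz) hw

/-- There is an algebraic class of character 0 (e.g. `e ⊠ e^∨`; needs some class to exist). -/
theorem exists_alg_achar_zero (e : Cl) : ∃ z : Cl, C.alg z ∧ C.achar z = 0 := by
  refine ⟨C.mul e (C.dual e), C.milne _ ?_, ?_⟩ <;>
    rw [C.achar_mul, C.achar_dual, add_neg_cancel]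

/-- Step (ii) iterated: an algebraic class whose character is any finite sum of characters
of algebraic classes (`e` only supplies an inhabitant for the empty case). -/
theorem exists_alg_achar_sum (e : Cl) :
    ∀ (n : ℕ) (w : Fin n → Cl), (∀ i, C.alg (w i)) →
      ∃ W : Cl, C.alg W ∧ C.achar W = ∑ i, C.achar (w i) := by
  intro n
  induction n with
  | zero =>
    intro w _
    obtain ⟨z, hz, hz0⟩ := C.exists_alg_achar_zero e
    exact ⟨z, hz, by simpa using hz0⟩
  | succ m ih =>
    intro w hw
    obtain ⟨W, hW, hWa⟩ := ih (fun i => w i.succ) (fun i => hw i.succ)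
    refine ⟨C.mul (w 0) W, C.alg_mul _ _ (hw 0) hW, ?_⟩
    rw [C.achar_mul, hWa, Fin.sum_univ_succ]

/-- [QW8] Theorem 2.5 "Sufficiency" (t:suff, l.245-249), abstract form, with the printed
sign hypothesis ε_α = ±1.  The proof mirrors steps (i)-(v) of the source. -/
theorem sufficiency {n : ℕ} (w : Fin n → Cl) (ε : Fin n → ℤ)
    (hε : ∀ i, ε i = 1 ∨ ε i = -1) (hw : ∀ i, C.alg (w i)) (e : Cl)
    (he : C.achar e = ∑ i, ε i • C.achar (w i)) : C.alg e := by
  -- step (i): replace w_α by its conjugate where ε_α = -1, so all signs become +1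
  let w' : Fin n → Cl := fun i => if ε i = 1 then w i else C.conj (w i)
  have hw'alg : ∀ i, C.alg (w' i) := by
    intro i
    show C.alg (if ε i = 1 then w i else C.conj (w i))
    split
    · exact hw i
    · exact C.alg_conj _ (hw i)
  have hw'a : ∀ i, C.achar (w' i) = ε i • C.achar (w i) := by
    intro i
    show C.achar (if ε i = 1 then w i else C.conj (w i)) = ε i • C.achar (w i)
    rcases hε i with h | h
    · rw [h, if_pos rfl, one_smul]
    · rw [h, if_neg (by norm_num), C.achar_conj, neg_smul, one_smul]
  -- step (ii): assemble one algebraic class with character ∑ a(w'_i)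
  obtain ⟨W, hWalg, hWa⟩ := C.exists_alg_achar_sum e n w' hw'alg
  -- steps (iii)-(v): pair off and push-pull
  refine C.alg_of_achar_eq hWalg ?_
  rw [hWa, he]
  exact Finset.sum_congr rfl fun i _ => (hw'a i).symm

/-- The set of Lefschetz characters of algebraic classes is a subgroup of V
([QW8] Remark 2.6(c); the inhabitant `e` supplies the zero element). -/
def algAcharSubgroup (e : Cl) : AddSubgroup V where
  carrier := {v : V | ∃ z : Cl, C.alg z ∧ C.achar z = v}
  zero_mem' := C.exists_alg_achar_zero e
  add_mem' := by
    rintro v₁ v₂ ⟨z₁, hz₁, rfl⟩ ⟨z₂, hz₂, rfl⟩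
    exact ⟨C.mul z₁ z₂, C.alg_mul _ _ hz₁ hz₂, C.achar_mul _ _⟩
  neg_mem' := by
    rintro v ⟨z, hz, rfl⟩
    exact ⟨C.conj z, C.alg_conj _ hz, C.achar_conj _⟩

/-- (no docstring in the 2001 source) -/
lemma mem_algAcharSubgroup {e : Cl} {v : V} :
    v ∈ C.algAcharSubgroup e ↔ ∃ z : Cl, C.alg z ∧ C.achar z = v := Iff.rfl

/-- Sufficiency with arbitrary integer coefficients — the form used by the corollary chain
(COR-CM (b3), (1e): repetitions of the w_α give any c_α ∈ ℤ). -/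
theorem sufficiency_int {n : ℕ} (w : Fin n → Cl) (cf : Fin n → ℤ)
    (hw : ∀ i, C.alg (w i)) (e : Cl)
    (he : C.achar e = ∑ i, cf i • C.achar (w i)) : C.alg e := by
  have hmem : C.achar e ∈ C.algAcharSubgroup e := by
    rw [he]
    refine AddSubgroup.sum_mem _ fun i _ => AddSubgroup.zsmul_mem _ ?_ (cf i)
    exact (C.mem_algAcharSubgroup).mpr ⟨w i, hw i, rfl⟩
  obtain ⟨z, hzalg, hza⟩ := (C.mem_algAcharSubgroup).mp hmem
  exact C.alg_of_achar_eq hzalg hza.symm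

end LefschetzCalculus

section SmokeTests

/-- Model: any subgroup S ≤ V, classes = V itself, a = id, algebraic = membership in S.
All seven axioms hold; `alg` is exactly S, so the axioms do NOT force `alg = ⊤`. -/
def subgroupModel (V : Type*) [AddCommGroup V] (S : AddSubgroup V) :
    LefschetzCalculus V V where
  alg v := v ∈ S
  achar := id
  conj := Neg.neg
  mul := (· + ·)
  dual := Neg.neg
  alg_conj := fun _ h => S.neg_mem h
  achar_conj := fun _ => rfl
  alg_mul := fun _ _ h₁ h₂ => S.add_mem h₁ h₂
  achar_mul := fun _ _ => rfl
  achar_dual := fun _ => rfl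
  milne := fun z h => by
    simp only [id_eq] at h
    rw [h]; exact S.zero_mem
  pushpull := fun e w h hw => by simpa using S.add_mem h hw

/-- Non-vacuity: in the model with S = 2ℤ ≤ ℤ, the class 1 is NOT "algebraic" … -/
example : ¬ (subgroupModel ℤ (AddSubgroup.zmultiples 2)).alg 1 := by
  intro h
  obtain ⟨k, hk⟩ := AddSubgroup.mem_zmultiples_iff.mp h
  simp only [smul_eq_mul] at hk
  omega

/-- … while 4 = 2·(a(2)) is, and `sufficiency_int` proves it from the generator 2. -/
example : (subgroupModel ℤ (AddSubgroup.zmultiples 2)).alg 4 := by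
  refine (subgroupModel ℤ (AddSubgroup.zmultiples 2)).sufficiency_int
    (n := 1) (fun _ => 2) (fun _ => 2)
    (fun _ => AddSubgroup.mem_zmultiples_iff.mpr ⟨1, one_smul ℤ (2 : ℤ)⟩) 4 ?_
  show (4 : ℤ) = ∑ _i : Fin 1, (2 : ℤ) • (2 : ℤ)
  simp

end SmokeTests

end Qw8Sufficiency



end HodgeCM.Prior.Qw8Sufficiency
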